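import Mathlib
import Summits.Ventures.HodgeRepro2.T5WedgeDet

/-!
# T5TopFormCharacter — top-degree forms transform by the determinant: «∧²(𝔭⁺)^* ≅ ℂ_det»

Blind cell `pub-hodge-repro2`, Tier-5 support for sub-step N1 (route/T5-ID-p2.md, Theorem ID(iv),
§ID-4(b)–(c)): «the wedge of two holomorphic 1-forms is the pointwise exterior product
F ∧ F′ : Γ_j\G_1 → ∧²(𝔭⁺)^* ≅ ℂ_det», i.e. the (2,0)-scalar functions picked out by the wedge
transform under `K_1` by the one-dimensional character by which `K_1` acts on the top exterior
power of `(𝔭⁺)^*`.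

Kernel content, for a module `M` with a finite basis `e` over a commutative ring `A` and a group
`K` acting on `M` through `ρ : Representation A K M`:

* §1 every top-degree alternating form `ω : M [⋀^ι]→ₗ[A] A` is `ω e • e.det`, and composing with a
  linear endomorphism `φ` multiplies it by `LinearMap.det φ`
  (`AlternatingMap.compLinearMap_eq_det_smul`); the space of top forms is one-dimensional
  (`topFormEquiv e : (M [⋀^ι]→ₗ[A] A) ≃ₗ[A] A`);
* §2 the induced (contragredient) action `topDual ρ` of `K` on top forms,
  `topDual ρ k ω = ω.compLinearMap (ρ k⁻¹)`, is the one-dimensional representation with character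
  `topChar ρ : K →* A`, `k ↦ LinearMap.det (ρ k⁻¹)` (`topDual_apply_eq_smul`,
  `topFormEquiv_topDual`), and `topChar ρ k * LinearMap.det (ρ k) = 1`;
* §3 for a vector space `V` over a field `𝕜` with the wedge `T5WedgeDet.wedge f g` of two covectors
  (p389719): the wedge is natural (`wedge_comp`), hence `K`-equivariant for Mathlib's dual action
  `ρ.dual` on covectors and `topDual ρ` on 2-forms (`wedge_dual_equivariant`), and its scalar
  component `minor e f g` transforms by `topChar ρ` (`minor_dual`) — the transformation law of the
  (2,0)-scalar function `F ∧ F′` under `K_1`; the wedge as a bilinear map `wedgeₗ`.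

For `M = 𝔭⁺ ≅ ℂ²` and `K_1 = U(2) × U(1)` this is the statement «∧²(𝔭⁺)^* is the character
`det⁻¹` of the `K_1`-action on `𝔭⁺`» used in ID-4(b)–(c) / route-2 §10.4's K-type bookkeeping.
What stays prose: which character of `K_1` the action on `𝔭⁺` is (std₂ ⊗ z⁻¹ — a computation in
the Lie algebra of `U(2,1)`, Liu Lemma D.2 / Konno–Konno).
-/

namespace Summit.Ventures.HodgeRepro2.T5TopFormCharacter

open Module

noncomputable section

section TopForms

variable {A : Type*} [CommRing A] {M : Type*} [AddCommGroup M] [Module A M]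
variable {ι : Type*} [DecidableEq ι] [Fintype ι]

/-- **Top-degree forms transform by the determinant**: composing a top-degree alternating form with
a linear endomorphism `φ` multiplies it by `LinearMap.det φ`. -/
theorem _root_.AlternatingMap.compLinearMap_eq_det_smul (e : Basis ι A M) (ω : M [⋀^ι]→ₗ[A] A)
    (φ : M →ₗ[A] M) : ω.compLinearMap φ = LinearMap.det φ • ω := by
  ext v
  have h := ω.eq_smul_basis_det e
  rw [AlternatingMap.compLinearMap_apply, AlternatingMap.smul_apply]
  conv_lhs => rw [h]
  conv_rhs => rw [h]
  have : (fun i => φ (v i)) = φ ∘ v := rfl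
  rw [AlternatingMap.smul_apply, AlternatingMap.smul_apply, this, Basis.det_comp]
  simp only [smul_eq_mul]
  ring

/-- The value of a top form on the basis determines it (`ω = ω e • e.det`). -/
theorem eq_of_apply_basis_eq (e : Basis ι A M) {ω ω' : M [⋀^ι]→ₗ[A] A} (h : ω e = ω' e) :
    ω = ω' := by
  rw [ω.eq_smul_basis_det e, ω'.eq_smul_basis_det e, h]

/-- **Top forms are one-dimensional**: evaluation on the basis `e` is a linear isomorphism
`(M [⋀^ι]→ₗ[A] A) ≃ₗ[A] A`, with inverse `c ↦ c • e.det`. -/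
def topFormEquiv (e : Basis ι A M) : (M [⋀^ι]→ₗ[A] A) ≃ₗ[A] A where
  toFun ω := ω e
  invFun c := c • e.det
  left_inv ω := (ω.eq_smul_basis_det e).symm
  right_inv c := by simp [Basis.det_self]
  map_add' ω ω' := rfl
  map_smul' c ω := rfl

/-- Evaluation of `topFormEquiv`. -/
@[simp] theorem topFormEquiv_apply (e : Basis ι A M) (ω : M [⋀^ι]→ₗ[A] A) :
    topFormEquiv e ω = ω e := rfl

/-- The inverse of `topFormEquiv`. -/
@[simp] theorem topFormEquiv_symm_apply (e : Basis ι A M) (c : A) :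
    (topFormEquiv e).symm c = c • e.det := rfl

/-- `e.det` corresponds to `1`. -/
theorem topFormEquiv_det (e : Basis ι A M) : topFormEquiv e e.det = 1 := Basis.det_self e

end TopForms

section Character

variable {A : Type*} [CommRing A] {M : Type*} [AddCommGroup M] [Module A M]
variable {ι : Type*} [DecidableEq ι] [Fintype ι]
variable {K : Type*} [Group K]

/-- The composition `ω ↦ ω.compLinearMap φ` as a linear map on top forms. -/
def compLinearMapₗ (φ : M →ₗ[A] M) : (M [⋀^ι]→ₗ[A] A) →ₗ[A] (M [⋀^ι]→ₗ[A] A) where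
  toFun ω := ω.compLinearMap φ
  map_add' ω ω' := AlternatingMap.add_compLinearMap ω ω' φ
  map_smul' c ω := by
    ext v
    simp only [AlternatingMap.compLinearMap_apply, AlternatingMap.smul_apply, RingHom.id_apply]

omit [DecidableEq ι] [Fintype ι] in
/-- Evaluation of `compLinearMapₗ`. -/
@[simp] theorem compLinearMapₗ_apply (φ : M →ₗ[A] M) (ω : M [⋀^ι]→ₗ[A] A) :
    compLinearMapₗ φ ω = ω.compLinearMap φ := rfl

/-- **The contragredient action on top forms**: for `ρ : Representation A K M`, `K` acts on the
top-degree forms by `k • ω := ω ∘ ρ k⁻¹` (the action induced on `∧^top M^*`). -/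
def topDual (ρ : Representation A K M) : Representation A K (M [⋀^ι]→ₗ[A] A) where
  toFun k := compLinearMapₗ (ρ k⁻¹)
  map_one' := by
    ext ω v
    simp only [inv_one, map_one, compLinearMapₗ_apply, Module.End.one_eq_id,
      AlternatingMap.compLinearMap_id, LinearMap.id_apply]
  map_mul' g h := by
    ext ω v
    simp only [mul_inv_rev, map_mul, compLinearMapₗ_apply, Module.End.mul_apply,
      AlternatingMap.compLinearMap_apply]

omit [DecidableEq ι] [Fintype ι] in
/-- Evaluation of `topDual`. -/
@[simp] theorem topDual_apply (ρ : Representation A K M) (k : K) (ω : M [⋀^ι]→ₗ[A] A) :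
    topDual ρ k ω = ω.compLinearMap (ρ k⁻¹) := rfl

/-- The character `k ↦ det (ρ k⁻¹)` of `K` (the determinant of the contragredient action). -/
def topChar (ρ : Representation A K M) : K →* A where
  toFun k := LinearMap.det (ρ k⁻¹)
  map_one' := by simp
  map_mul' g h := by
    simp only [mul_inv_rev, map_mul, Module.End.mul_eq_comp, LinearMap.det_comp]
    ring

/-- Evaluation of `topChar`. -/
@[simp] theorem topChar_apply (ρ : Representation A K M) (k : K) :
    topChar ρ k = LinearMap.det (ρ k⁻¹) := rfl

/-- `topChar ρ k` is the inverse of `det (ρ k)`: `det (ρ k⁻¹) * det (ρ k) = 1`. -/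
theorem topChar_mul_det (ρ : Representation A K M) (k : K) :
    topChar ρ k * LinearMap.det (ρ k) = 1 := by
  rw [topChar_apply, ← LinearMap.det_comp, ← Module.End.mul_eq_comp, ← map_mul, inv_mul_cancel,
    map_one, Module.End.one_eq_id, LinearMap.det_id]

/-- `det (ρ k)` is a unit. -/
theorem isUnit_det (ρ : Representation A K M) (k : K) : IsUnit (LinearMap.det (ρ k)) :=
  IsUnit.of_mul_eq_one _ (by rw [mul_comm]; exact topChar_mul_det ρ k)

/-- **Top forms are the one-dimensional representation with character `topChar ρ`**:
`topDual ρ k ω = det (ρ k⁻¹) • ω`. -/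
theorem topDual_apply_eq_smul (e : Basis ι A M) (ρ : Representation A K M) (k : K)
    (ω : M [⋀^ι]→ₗ[A] A) : topDual ρ k ω = topChar ρ k • ω := by
  rw [topDual_apply, topChar_apply, AlternatingMap.compLinearMap_eq_det_smul e]

/-- Through `topFormEquiv`, the action on top forms is multiplication by the character. -/
theorem topFormEquiv_topDual (e : Basis ι A M) (ρ : Representation A K M) (k : K)
    (ω : M [⋀^ι]→ₗ[A] A) : topFormEquiv e (topDual ρ k ω) = topChar ρ k * topFormEquiv e ω := by
  rw [topDual_apply_eq_smul e, map_smul, smul_eq_mul]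

/-- The basis form `e.det` is an eigenvector: `topDual ρ k e.det = topChar ρ k • e.det`. -/
theorem topDual_det (e : Basis ι A M) (ρ : Representation A K M) (k : K) :
    topDual ρ k e.det = topChar ρ k • e.det :=
  topDual_apply_eq_smul e ρ k e.det

/-- The action on top forms is trivial on the kernel of `topChar` (e.g. on `SU`). -/
theorem topDual_eq_self_of_topChar_eq_one (e : Basis ι A M) (ρ : Representation A K M) {k : K}
    (hk : topChar ρ k = 1) (ω : M [⋀^ι]→ₗ[A] A) : topDual ρ k ω = ω := by
  rw [topDual_apply_eq_smul e, hk, one_smul]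

end Character

section Wedge

open Summit.Ventures.HodgeRepro2.T5WedgeDet

variable {𝕜 : Type*} [Field 𝕜] {V : Type*} [AddCommGroup V] [Module 𝕜 V]
variable {K : Type*} [Group K]

/-- **Naturality of the wedge**: `(f ∘ φ) ∧ (g ∘ φ) = (f ∧ g) ∘ φ`. -/
theorem wedge_comp (f g : V →ₗ[𝕜] 𝕜) (φ : V →ₗ[𝕜] V) :
    wedge (f ∘ₗ φ) (g ∘ₗ φ) = (wedge f g).compLinearMap φ := by
  ext v
  simp only [wedge_apply, AlternatingMap.compLinearMap_apply, LinearMap.comp_apply]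

/-- **The wedge is `K`-equivariant**: for the dual action `ρ.dual` on covectors (Mathlib:
`ρ.dual k f = f ∘ ρ k⁻¹`) and the contragredient action `topDual ρ` on 2-forms,
`(k • f) ∧ (k • g) = k • (f ∧ g)`. -/
theorem wedge_dual_equivariant (ρ : Representation 𝕜 K V) (k : K) (f g : V →ₗ[𝕜] 𝕜) :
    wedge (ρ.dual k f) (ρ.dual k g) = topDual ρ k (wedge f g) := by
  rw [topDual_apply, ← wedge_comp]
  rfl

/-- **The (2,0)-scalar transforms by the character**: for a basis `e` of `V` (`Fin 2`),
`minor e (k • f) (k • g) = topChar ρ k * minor e f g` — the transformation law under `K_1` of the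
scalar function `F ∧ F′ = minor · e.det` of N1 ID-4(b)–(c) (`∧²(𝔭⁺)^* ≅ ℂ_det`). -/
theorem minor_dual (e : Basis (Fin 2) 𝕜 V) (ρ : Representation 𝕜 K V) (k : K)
    (f g : V →ₗ[𝕜] 𝕜) : minor e (ρ.dual k f) (ρ.dual k g) = topChar ρ k * minor e f g := by
  have h1 : minor e (ρ.dual k f) (ρ.dual k g) = topFormEquiv e (wedge (ρ.dual k f) (ρ.dual k g)) := by
    rw [topFormEquiv_apply, wedge_eq_minor_smul_det e, AlternatingMap.smul_apply, Basis.det_self,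
      smul_eq_mul, mul_one]
  have h2 : minor e f g = topFormEquiv e (wedge f g) := by
    rw [topFormEquiv_apply, wedge_eq_minor_smul_det e, AlternatingMap.smul_apply, Basis.det_self,
      smul_eq_mul, mul_one]
  rw [h1, h2, wedge_dual_equivariant, topFormEquiv_topDual]

/-- The minor is the value of the wedge on the basis. -/
theorem minor_eq_wedge_apply_basis (e : Basis (Fin 2) 𝕜 V) (f g : V →ₗ[𝕜] 𝕜) :
    minor e f g = wedge f g e := by
  rw [wedge_eq_minor_smul_det e, AlternatingMap.smul_apply, Basis.det_self, smul_eq_mul, mul_one]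

/-- The wedge as a bilinear map `V^* →ₗ V^* →ₗ (V [⋀^Fin 2]→ₗ 𝕜)` (the coefficient bilinear map of
the pointwise product of two `(𝔭⁺)^*`-valued functions). -/
def wedgeₗ : (V →ₗ[𝕜] 𝕜) →ₗ[𝕜] (V →ₗ[𝕜] 𝕜) →ₗ[𝕜] (V [⋀^Fin 2]→ₗ[𝕜] 𝕜) :=
  LinearMap.mk₂ 𝕜 wedge
    (fun f₁ f₂ g => by ext v; simp only [wedge_apply, LinearMap.add_apply,
      AlternatingMap.add_apply]; ring)
    (fun c f g => by ext v; simp only [wedge_apply, LinearMap.smul_apply,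
      AlternatingMap.smul_apply, smul_eq_mul]; ring)
    (fun f g₁ g₂ => by ext v; simp only [wedge_apply, LinearMap.add_apply,
      AlternatingMap.add_apply]; ring)
    (fun c f g => by ext v; simp only [wedge_apply, LinearMap.smul_apply,
      AlternatingMap.smul_apply, smul_eq_mul]; ring)

/-- Evaluation of `wedgeₗ`. -/
@[simp] theorem wedgeₗ_apply (f g : V →ₗ[𝕜] 𝕜) : wedgeₗ f g = wedge f g := rfl

/-- The equivariance of `wedgeₗ` in the form `B (ρ k v) (ρ' k v') = ρ'' k (B v v')` (the hypothesis
shape `IsEquivariantBilinear` of `T5EquivariantWedge`, stated here without that import). -/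
theorem wedgeₗ_equivariant (ρ : Representation 𝕜 K V) (k : K) (f g : V →ₗ[𝕜] 𝕜) :
    wedgeₗ (ρ.dual k f) (ρ.dual k g) = topDual ρ k (wedgeₗ f g) :=
  wedge_dual_equivariant ρ k f g

end Wedge

end

end Summit.Ventures.HodgeRepro2.T5TopFormCharacter
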